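import Summits.KontsevichZagierPeriods.KontsevichZagierPeriods.Theorems.LinRedNormalFormArrangementNormalFormStubRebaseSimplePosManyGeneric

/-!
# Stub `stub_rebaseSimplePosMany`, part `rebaseSimplePosMany_product` (crux `ArrangementNormalForm`, line `janus-bands`) — the part

The PRODUCT case of the rebase with a simple base pole over a base of dimension `B + 1 ≥ 1`
with any number `K` of fibres (literal class `GS B K` / `GG B σ K` text, every fibre bound an
affine function of the base):
* `RebaseMany.isProd_of_literal` — READING a literal product datum as a product representation:
  the `K` redundant rows `Vᵢ − Uᵢ > 0` are appended to the base cell (same domain,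
  `RebaseMany.pDom_append`), so that the base cell becomes the projection of the (bounded) domain
  and has bounded base coordinates (`RebaseMany.cell_append_cbd`);
* `RebaseMany.good_literal_tame` / `rebaseSimplePosMany_product_tame` (registered, UNCONDITIONAL):
  if every fibre is letter-free, has a bound parallel in `y` to its letter, or is thick
  (`Vᵢ − Uᵢ ≥ c₀ > 0` on the domain), the representation is congruent modulo `KZ.relations` to a
  `ℤ`-combination of elements of the rebased class `GG B 2 K` (fibre-by-fibre induction of part
  `Fibre`: shears, sign cuts of the base cell, level cuts, reflections, Janus extensions to
  constant levels with dominated wedges — rules 1a and 2, uniformly in the silent coordinates);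
* `RebaseMany.good_literal_of_oracle` / `rebaseSimplePosMany_product_of_oracle`: the general
  product case REDUCED to the residual oracle `RebaseMany.HRes` (thin parallel bands and corner
  bands of one fibre in the presence of spectators; the one-fibre proofs of these residues at
  `B = 1` use base changes — coordinate swap `y ↔ t`, corner blow-ups of the base — which do not
  preserve the product structure of the spectators, so they do not port fibre by fibre);
* `RebaseMany.good_literal_generic` / `rebaseSimplePosMany_product_generic` (registered rider,
  UNCONDITIONAL): product fibres in GENERAL POSITION over the closed base cell (part `Generic`:
  every pinch point of a transverse lettered fibre has non-parallel bounds and lies off the letter);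
* `rebaseSimplePosMany_product_tame'` / `rebaseSimplePosMany_product_generic'`: the same in the
  skeleton's spelling (`GG`, `hGG`), with the wide target of the stub (closure of `GG B 2 K ∪ …`).

References: M. Kontsevich, D. Zagier, *Periods* (2001), §1.2.
-/

noncomputable section

open Set MeasureTheory MvPolynomial
open Literature.NumberTheory.Transcendental Literature.ModelTheory.ExponentialFields

namespace Summit.KontsevichZagierPeriods.ArrangementNormalForm.JanusBands

namespace RebaseMany

open SeparatePos RebasePos

variable {B K : ℕ}

/-! ### Reading the literal datum -/

/-- Membership in the base cell with the `K` redundant rows `Vᵢ − Uᵢ` appended. [folklore] -/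
theorem mem_cell_append {m' : ℕ} (M : Fin m' → Cf B) (U V : Fin K → Cf B) (z : Fin (B + 1 + K) → ℝ) :
    z ∈ cell K (Fin.append M (fun i => V i - U i) : Fin (m' + K) → Cf B) ↔
      z ∈ cell K M ∧ ∀ i, affF B K (U i) z < affF B K (V i) z := by
  simp only [cell, mem_setOf_eq]
  constructor
  · intro h
    refine ⟨fun j => ?_, fun i => ?_⟩
    · simpa only [Fin.append_left] using h (Fin.castAdd K j)
    · have := h (Fin.natAdd m' i)
      rwa [Fin.append_right, affF_sub, sub_pos] at this
  · rintro ⟨h1, h2⟩ j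
    refine Fin.addCases (fun j => ?_) (fun i => ?_) j
    · rw [Fin.append_left]; exact h1 j
    · rw [Fin.append_right, affF_sub, sub_pos]; exact h2 i

/-- Appending the redundant rows does not change the product domain. [folklore] -/
theorem pDom_append {m' : ℕ} (M : Fin m' → Cf B) (U V : Fin K → Cf B) :
    pDom (Fin.append M (fun i => V i - U i) : Fin (m' + K) → Cf B) U V = pDom M U V := by
  ext z
  rw [mem_pDom, mem_pDom, mem_cell_append]
  constructor
  · rintro ⟨⟨hy, -⟩, hf⟩; exact ⟨hy, hf⟩
  · rintro ⟨hy, hf⟩; exact ⟨⟨hy, fun i => (hf i).1.trans (hf i).2⟩, hf⟩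

/-- The point of the product domain above a point of the extended base cell with every fibre at
mid-height. [folklore] -/
theorem exists_mem_pDom_of_mem_cell_append {m' : ℕ} (M : Fin m' → Cf B) (U V : Fin K → Cf B)
    {z : Fin (B + 1 + K) → ℝ} (hz : z ∈ cell K (Fin.append M (fun i => V i - U i) : Fin (m' + K) → Cf B)) :
    ∃ z' ∈ pDom M U V, ∀ j : Fin (B + 1), z' (Fin.castAdd K j) = z (Fin.castAdd K j) := by
  rw [mem_cell_append] at hz
  set z' : Fin (B + 1 + K) → ℝ :=
    Fin.append (fun j : Fin (B + 1) => z (Fin.castAdd K j)) (fun i => (affF B K (U i) z + affF B K (V i) z) / 2)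
    with hz'
  have hb : ∀ j : Fin (B + 1), z' (Fin.castAdd K j) = z (Fin.castAdd K j) := fun j => by
    simp only [hz', Fin.append_left]
  have ht : ∀ i, z' (Fin.natAdd (B + 1) i) = (affF B K (U i) z + affF B K (V i) z) / 2 := fun i => by
    simp only [hz', Fin.append_right]
  refine ⟨z', ?_, hb⟩
  rw [mem_pDom, mem_cell_congr M hb]
  refine ⟨hz.1, fun i => ?_⟩
  rw [ht, affF_congr (U i) hb, affF_congr (V i) hb]
  constructor <;> linarith [hz.2 i]

/-- **The extended base cell has bounded base coordinates** as soon as the product domain is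
bounded: it is the projection of the domain. [folklore] -/
theorem cell_append_cbd {m' : ℕ} (M : Fin m' → Cf B) (U V : Fin K → Cf B)
    (hbd : Bornology.IsBounded (pDom M U V)) :
    ∃ R : ℝ, ∀ z ∈ cell K (Fin.append M (fun i => V i - U i) : Fin (m' + K) → Cf B),
      ∀ j : Fin (B + 1), |z (Fin.castAdd K j)| ≤ R := by
  obtain ⟨R, hR⟩ := hbd.exists_norm_le
  refine ⟨R, fun z hz j => ?_⟩
  obtain ⟨z', hz', hb⟩ := exists_mem_pDom_of_mem_cell_append M U V hz
  have h1 := norm_le_pi_norm z' (Fin.castAdd K j)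
  rw [Real.norm_eq_abs, hb j] at h1
  exact h1.trans (hR _ hz')

/-- Thickness on the domain is thickness on the extended base cell. [folklore] -/
theorem thick_cell_append {m' : ℕ} (M : Fin m' → Cf B) (U V : Fin K → Cf B) (u v : Cf B) (c₀ : ℝ)
    (h : ∀ z ∈ pDom M U V, affF B K u z + c₀ ≤ affF B K v z) :
    ∀ z ∈ cell K (Fin.append M (fun i => V i - U i) : Fin (m' + K) → Cf B), affF B K u z + c₀ ≤ affF B K v z := by
  intro z hz
  obtain ⟨z', hz', hb⟩ := exists_mem_pDom_of_mem_cell_append M U V hz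
  rw [← affF_congr u hb, ← affF_congr v hb]
  exact h z' hz'

/-- **Reading a literal product datum** (affine bounds `Uᵢ < tᵢ < Vᵢ`, literal domain and
integrand, bounded domain) as a product representation over the extended base cell. [folklore] -/
theorem isProd_of_literal {m m' n₁ n₂ : ℕ} (s : KZ.IntegralRep (B + 1 + K)) (M : Fin m' → Cf B)
    (L : Fin m → (Fin B → ℚ) × ℚ) (e : Fin m → ℕ) (p : MvPolynomial (Fin B) ℚ)
    (ℓ₁ ℓ₂ : (Fin B → ℚ) × ℚ) (a : Fin K → Option (Cf B)) (lo hi : Fin K → Fin K ⊕ Cf B)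
    (U V : Fin K → Cf B) (hlo : ∀ i, lo i = Sum.inr (U i)) (hhi : ∀ i, hi i = Sum.inr (V i))
    (h12 : n₁ = 0 ∨ n₂ = 0) (hbd : Bornology.IsBounded s.domain)
    (hdom : s.domain = gDom B K m' M lo hi)
    (hint : EqOn s.integrand (glit B K p L e ℓ₁ ℓ₂ n₁ n₂ a) s.domain) :
    IsProd s (Fin.append M (fun i => V i - U i) : Fin (m' + K) → Cf B) U V ⟨m, L, e, ℓ₁, ℓ₂, n₁, n₂⟩ p a := by
  have hlo' : lo = fun i => Sum.inr (U i) := funext hlo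
  have hhi' : hi = fun i => Sum.inr (V i) := funext hhi
  have hd : s.domain = pDom M U V := by rw [hdom, hlo', hhi']; rfl
  have hbd' : Bornology.IsBounded (pDom M U V) := hd ▸ hbd
  exact ⟨by rw [pDom_append, hd], hint, h12, cell_append_cbd M U V hbd'⟩

/-- **The tame product case on the literal class** (unconditional). A representation with a
literal `GG B σ K` datum (any `n₁ n₂` with `n₁ = 0 ∨ n₂ = 0`), affine fibre bounds `Uᵢ < tᵢ < Vᵢ`,
every fibre letter-free, or with a bound parallel in `y` to its letter, or thick on the domain
(`Uᵢ + c₀ ≤ Vᵢ`), is congruent modulo `KZ.relations` to a `ℤ`-combination of elements of the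
literal rebased class `SeparatePos.GGset B 2 K`. [folklore] -/
theorem good_literal_tame {m m' n₁ n₂ : ℕ} (s : KZ.IntegralRep (B + 1 + K)) (M : Fin m' → Cf B)
    (L : Fin m → (Fin B → ℚ) × ℚ) (e : Fin m → ℕ) (p : MvPolynomial (Fin B) ℚ)
    (ℓ₁ ℓ₂ : (Fin B → ℚ) × ℚ) (a : Fin K → Option (Cf B)) (lo hi : Fin K → Fin K ⊕ Cf B)
    (U V : Fin K → Cf B) (hlo : ∀ i, lo i = Sum.inr (U i)) (hhi : ∀ i, hi i = Sum.inr (V i))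
    (h12 : n₁ = 0 ∨ n₂ = 0) (hbd : Bornology.IsBounded s.domain)
    (hdom : s.domain = gDom B K m' M lo hi)
    (hint : EqOn s.integrand (glit B K p L e ℓ₁ ℓ₂ n₁ n₂ a) s.domain)
    (htame : ∀ i, (∀ c, a i = some c →
        (U i).1 (Fin.last B) = c.1 (Fin.last B) ∨ (V i).1 (Fin.last B) = c.1 (Fin.last B)) ∨
      ∃ c₀ : ℝ, 0 < c₀ ∧ ∀ z ∈ s.domain, affF B K (U i) z + c₀ ≤ affF B K (V i) z) :
    ∃ c ∈ AddSubgroup.closure (GGset B 2 K), KZ.of s - c ∈ KZ.relations := by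
  have h := isProd_of_literal s M L e p ℓ₁ ℓ₂ a lo hi U V hlo hhi h12 hbd hdom hint
  have hd : s.domain = pDom M U V := by rw [hdom, funext hlo, funext hhi]; rfl
  refine good_isProd_tame h fun j => ?_
  rcases htame j with ht | ⟨c₀, hc₀, ht⟩
  · exact Or.inl ht
  · exact Or.inr ⟨c₀, hc₀, thick_cell_append M U V (U j) (V j) c₀ fun z hz => ht z (by rw [hd]; exact hz)⟩

/-- **The product case on the literal class from the residual oracle.** [folklore] -/
theorem good_literal_of_oracle {m m' n₁ n₂ : ℕ} (s : KZ.IntegralRep (B + 1 + K)) (M : Fin m' → Cf B)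
    (L : Fin m → (Fin B → ℚ) × ℚ) (e : Fin m → ℕ) (p : MvPolynomial (Fin B) ℚ)
    (ℓ₁ ℓ₂ : (Fin B → ℚ) × ℚ) (a : Fin K → Option (Cf B)) (lo hi : Fin K → Fin K ⊕ Cf B)
    (U V : Fin K → Cf B) (hlo : ∀ i, lo i = Sum.inr (U i)) (hhi : ∀ i, hi i = Sum.inr (V i))
    (h12 : n₁ = 0 ∨ n₂ = 0) (hbd : Bornology.IsBounded s.domain)
    (hdom : s.domain = gDom B K m' M lo hi)
    (hint : EqOn s.integrand (glit B K p L e ℓ₁ ℓ₂ n₁ n₂ a) s.domain)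
    (hO : HRes K (⟨m, L, e, ℓ₁, ℓ₂, n₁, n₂⟩ : BData B)) :
    ∃ c ∈ AddSubgroup.closure (GGset B 2 K), KZ.of s - c ∈ KZ.relations :=
  good_isProd_of_oracle hO (isProd_of_literal s M L e p ℓ₁ ℓ₂ a lo hi U V hlo hhi h12 hbd hdom hint)

/-- Non-strict rows of the extended base cell. [folklore] -/
theorem rows_le_append_iff {m' : ℕ} (M : Fin m' → Cf B) (U V : Fin K → Cf B) (z : Fin (B + 1 + K) → ℝ) :
    (∀ j, 0 ≤ affF B K ((Fin.append M (fun i => V i - U i) : Fin (m' + K) → Cf B) j) z) ↔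
      (∀ j, 0 ≤ affF B K (M j) z) ∧ ∀ i, affF B K (U i) z ≤ affF B K (V i) z := by
  constructor
  · intro h
    refine ⟨fun j => ?_, fun i => ?_⟩
    · simpa only [Fin.append_left] using h (Fin.castAdd K j)
    · have := h (Fin.natAdd m' i)
      rwa [Fin.append_right, affF_sub, sub_nonneg] at this
  · rintro ⟨h1, h2⟩ j
    refine Fin.addCases (fun j => ?_) (fun i => ?_) j
    · rw [Fin.append_left]; exact h1 j
    · rw [Fin.append_right, affF_sub, sub_nonneg]; exact h2 i

/-- **The product case on the literal class IN GENERAL POSITION** (unconditional). A representation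
with a literal `GG B σ K` datum (any `n₁ n₂` with `n₁ = 0 ∨ n₂ = 0`) and affine fibre bounds
`Uᵢ < tᵢ < Vᵢ` such that every lettered fibre with both bounds transverse in `y` to its letter `cᵢ`
is in general position over the closed base cell `{rows ≥ 0, ∀ i', U_{i'} ≤ V_{i'}}` (at every
pinch point `Uᵢ = Vᵢ` there, the bounds are non-parallel in `y` and `Uᵢ ≠ cᵢ`) is congruent modulo
`KZ.relations` to a `ℤ`-combination of elements of the literal rebased class
`SeparatePos.GGset B 2 K`. [folklore] -/
theorem good_literal_generic {m m' n₁ n₂ : ℕ} (s : KZ.IntegralRep (B + 1 + K)) (M : Fin m' → Cf B)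
    (L : Fin m → (Fin B → ℚ) × ℚ) (e : Fin m → ℕ) (p : MvPolynomial (Fin B) ℚ)
    (ℓ₁ ℓ₂ : (Fin B → ℚ) × ℚ) (a : Fin K → Option (Cf B)) (lo hi : Fin K → Fin K ⊕ Cf B)
    (U V : Fin K → Cf B) (hlo : ∀ i, lo i = Sum.inr (U i)) (hhi : ∀ i, hi i = Sum.inr (V i))
    (h12 : n₁ = 0 ∨ n₂ = 0) (hbd : Bornology.IsBounded s.domain)
    (hdom : s.domain = gDom B K m' M lo hi)
    (hint : EqOn s.integrand (glit B K p L e ℓ₁ ℓ₂ n₁ n₂ a) s.domain)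
    (hgen : ∀ i c, a i = some c → (U i).1 (Fin.last B) ≠ c.1 (Fin.last B) →
      (V i).1 (Fin.last B) ≠ c.1 (Fin.last B) → ∀ z : Fin (B + 1 + K) → ℝ,
      (∀ j, 0 ≤ affF B K (M j) z) → (∀ i', affF B K (U i') z ≤ affF B K (V i') z) →
      affF B K (U i) z = affF B K (V i) z →
      (U i).1 (Fin.last B) ≠ (V i).1 (Fin.last B) ∧ affF B K (U i) z ≠ affF B K c z) :
    ∃ c ∈ AddSubgroup.closure (GGset B 2 K), KZ.of s - c ∈ KZ.relations := by
  refine good_isProd_generic (isProd_of_literal s M L e p ℓ₁ ℓ₂ a lo hi U V hlo hhi h12 hbd hdom hint)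
    fun j c hc hu hv z hz huv => ?_
  obtain ⟨h1, h2⟩ := (rows_le_append_iff M U V z).1 hz
  exact hgen j c hc hu hv z h1 h2 huv

/-- Widening the target class. [folklore] -/
theorem good_widen {S S' : Set KZ.FormalRep} (hSS' : S ⊆ S') {x : KZ.FormalRep}
    (h : ∃ c ∈ AddSubgroup.closure S, x - c ∈ KZ.relations) :
    ∃ c ∈ AddSubgroup.closure S', x - c ∈ KZ.relations := by
  obtain ⟨c, hc, hx⟩ := h
  exact ⟨c, AddSubgroup.closure_mono hSS' hc, hx⟩

end RebaseMany

/-- **Registered part `rebaseSimplePosMany_product_tame` of `stub_rebaseSimplePosMany` (line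
`janus-bands`): product fibres over a base of dimension `B + 1`, any number `K` of fibres, TAME
fibres — unconditional.** A representation with the literal `GG B σ K`-type datum (base
`(x', y) ∈ ℝ^{B+1}` in a bounded rational polyhedral cell, base factor
`p(x')/∏ Lⱼ(x')^{eⱼ} · (y − ℓ₁)^{n₁}/(y − ℓ₂)^{n₂}` with `n₁ = 0 ∨ n₂ = 0`, `K` fibres `tᵢ` with
optional letters `1/(tᵢ − cᵢ(x', y))`) all of whose fibre bounds are affine forms `Uᵢ, Vᵢ` of the
base, and such that every fibre is letter-free, has a bound parallel in `y` to its letter, or is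
thick on the domain (`Uᵢ + c₀ ≤ Vᵢ`, `c₀ > 0`), is congruent modulo `KZ.relations` to a
`ℤ`-combination of elements of the literal rebased class `GG B 2 K` (`y`-free letters, bounds
`y`-free or exactly `y`): `RebaseMany.good_literal_tame`. -/
theorem rebaseSimplePosMany_product_tame (B K m m' n₁ n₂ : ℕ) (s : KZ.IntegralRep (B + 1 + K)) (M : Fin m' → (Fin (B + 1) → ℚ) × ℚ) (L : Fin m → (Fin B → ℚ) × ℚ) (e : Fin m → ℕ) (p : MvPolynomial (Fin B) ℚ) (ℓ₁ ℓ₂ : (Fin B → ℚ) × ℚ) (a : Fin K → Option ((Fin (B + 1) → ℚ) × ℚ)) (lo hi : Fin K → Fin K ⊕ ((Fin (B + 1) → ℚ) × ℚ)) (U V : Fin K → (Fin (B + 1) → ℚ) × ℚ) (hlo : ∀ i, lo i = Sum.inr (U i)) (hhi : ∀ i, hi i = Sum.inr (V i)) (h12 : n₁ = 0 ∨ n₂ = 0) (hbd : Bornology.IsBounded s.domain) (hdom : s.domain = SeparatePos.gDom B K m' M lo hi) (hint : EqOn s.integrand (RebasePos.glit B K p L e ℓ₁ ℓ₂ n₁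 n₂ a) s.domain) (htame : ∀ i, (∀ c, a i = some c → (U i).1 (Fin.last B) = c.1 (Fin.last B) ∨ (V i).1 (Fin.last B) = c.1 (Fin.last B)) ∨ ∃ c₀ : ℝ, 0 < c₀ ∧ ∀ z ∈ s.domain, SeparatePos.affF B K (U i) z + c₀ ≤ SeparatePos.affF B K (V i) z) : ∃ c ∈ AddSubgroup.closure (SeparatePos.GGset B 2 K), KZ.of s - c ∈ KZ.relations :=
  RebaseMany.good_literal_tame s M L e p ℓ₁ ℓ₂ a lo hi U V hlo hhi h12 hbd hdom hint htame

/-- **Registered part `rebaseSimplePosMany_product_generic` of `stub_rebaseSimplePosMany` (line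
`janus-bands`): product fibres in GENERAL POSITION over a base of dimension `B + 1`, any number
`K` of fibres — unconditional.** As `rebaseSimplePosMany_product_tame`, for data such that every
lettered fibre with both bounds transverse in `y` to its letter is in general position over the
closed base cell (`RebaseMany.good_literal_generic`): the fibre-by-fibre induction (shears, sign
cuts of the base cell, level cuts, reflections, coaxial blow-ups, Janus extensions with dominated
wedges, compactness dichotomy; rules 1a and 2, uniformly in the silent coordinates) never meets a
pinched parallel band or a corner band. -/
theorem rebaseSimplePosMany_product_generic (B K m m' n₁ n₂ : ℕ) (s : KZ.IntegralRep (B + 1 + K)) (M : Fin m' → (Fin (B + 1) → ℚ) × ℚ) (L : Fin m → (Fin B → ℚ) × ℚ) (e : Fin m → ℕ) (p : MvPolynomial (Fin B) ℚ) (ℓ₁ ℓ₂ : (Fin B → ℚ) × ℚ) (a : Fin K → Option ((Fin (B + 1) → ℚ) × ℚ)) (lo hi : Fin K → Fin K ⊕ ((Fin (B + 1) → ℚ) × ℚ)) (U V : Fin K → (Fin (B + 1) → ℚ) × ℚ) (hlo : ∀ i, lo i = Sum.inr (U i)) (hhi : ∀ i, hi i = Sum.inr (V i)) (h12 : n₁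 = 0 ∨ n₂ = 0) (hbd : Bornology.IsBounded s.domain) (hdom : s.domain = SeparatePos.gDom B K m' M lo hi) (hint : EqOn s.integrand (RebasePos.glit B K p L e ℓ₁ ℓ₂ n₁ n₂ a) s.domain) (hgen : ∀ i c, a i = some c → (U i).1 (Fin.last B) ≠ c.1 (Fin.last B) → (V i).1 (Fin.last B) ≠ c.1 (Fin.last B) → ∀ z : Fin (B + 1 + K) → ℝ, (∀ j, 0 ≤ SeparatePos.affF B K (M j) z) → (∀ i', SeparatePos.affF B K (U i') z ≤ SeparatePos.affF B K (V i') z) → SeparatePos.affF B K (U i) z = SeparatePos.affF B K (V i) z → (U i).1 (Fin.last B) ≠ (V i).1 (Fin.last B) ∧ SeparatePos.affF B K (U i) z ≠ SeparatePos.affF B K c z) : ∃ c ∈ AddSubgroup.closure (SeparatePos.GGset B 2 K), KZ.of s - c ∈ KZ.relations :=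
  RebaseMany.good_literal_generic s M L e p ℓ₁ ℓ₂ a lo hi U V hlo hhi h12 hbd hdom hint hgen

/-- **The general product case of `stub_rebaseSimplePosMany` reduced to the residual oracle**
(literal binders): given `RebaseMany.HRes K T` for the base-factor data `T` of the datum, a
representation with a literal product datum over a base of dimension `B + 1` with `K` fibres is
congruent modulo `KZ.relations` to the subgroup generated by `GG B 2 K`. -/
theorem rebaseSimplePosMany_product_of_oracle (B K m m' n₁ n₂ : ℕ) (s : KZ.IntegralRep (B + 1 + K)) (M : Fin m' → (Fin (B + 1) → ℚ) × ℚ) (L : Fin m → (Fin B → ℚ) × ℚ) (e : Fin m → ℕ) (p : MvPolynomial (Fin B) ℚ) (ℓ₁ ℓ₂ : (Fin B → ℚ) × ℚ) (a : Fin K → Option ((Fin (B + 1) → ℚ) × ℚ)) (lo hi : Fin K → Fin K ⊕ ((Fin (B + 1) → ℚ) × ℚ)) (U V : Fin K → (Fin (B + 1) → ℚ) × ℚ) (hlo : ∀ i, lo i = Sum.inr (U i)) (hhi : ∀ i, hi i = Sum.inr (V i)) (h12 : n₁ = 0 ∨ n₂ = 0) (hbd : Bornology.IsBounded s.domain) (hdom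 : s.domain = SeparatePos.gDom B K m' M lo hi) (hint : EqOn s.integrand (RebasePos.glit B K p L e ℓ₁ ℓ₂ n₁ n₂ a) s.domain) (hO : RebaseMany.HRes K (⟨m, L, e, ℓ₁, ℓ₂, n₁, n₂⟩ : RebaseMany.BData B)) : ∃ c ∈ AddSubgroup.closure (SeparatePos.GGset B 2 K), KZ.of s - c ∈ KZ.relations :=
  RebaseMany.good_literal_of_oracle s M L e p ℓ₁ ℓ₂ a lo hi U V hlo hhi h12 hbd hdom hint hO

/-- **The tame product case in the skeleton's spelling** (`GG`, `hGG`; the stub's base dimension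
`b + 2`, `k + 2` fibres, `n₂ = 1`, wide target `GG (b+1) 2 (k+2) ∪ JJ' ∪ JD'` for ANY sets
`JJ'`, `JD'`): product fibres all of which are tame. -/
theorem rebaseSimplePosMany_product_tame' (GG : ℕ → ℕ → ℕ → Set KZ.FormalRep) (hGG : ∀ b σ k, GG b σ k = {w : KZ.FormalRep | ∃ (m m' n₁ n₂ : ℕ) (s : KZ.IntegralRep (b + 1 + k)) (M : Fin m' → (Fin (b + 1) → ℚ) × ℚ) (L : Fin m → (Fin b → ℚ) × ℚ) (e : Fin m → ℕ) (p : MvPolynomial (Fin b) ℚ) (ℓ₁ ℓ₂ : (Fin b → ℚ) × ℚ) (a : Fin k → Option ((Fin (b + 1) → ℚ) × ℚ)) (lo hi : Fin k → Fin k ⊕ ((Fin (b + 1) → ℚ) × ℚ)), (n₁ = 0 ∨ n₂ = 0) ∧ (σ = 2 → (∀ i c, a i = some c → c.1 (Fin.last b) = 0) ∧ (∀ i c, (lo i = Sum.inr c ∨ hi i = Sum.inr c) → (c.1 (Fin.last b) = 0 ∨ c = (Pi.single (Fin.last b) 1, 0)))) ∧ Bornology.IsBounded s.domain ∧ s.domain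 = {z | (∀ j, 0 < ∑ i, ((M j).1 i : ℝ) * z (Fin.castAdd k i) + ((M j).2 : ℝ)) ∧ ∀ i, Sum.elim (fun j => z (Fin.natAdd (b + 1) j)) (fun c => ∑ i', (c.1 i' : ℝ) * z (Fin.castAdd k i') + (c.2 : ℝ)) (lo i) < z (Fin.natAdd (b + 1) i) ∧ z (Fin.natAdd (b + 1) i) < Sum.elim (fun j => z (Fin.natAdd (b + 1) j)) (fun c => ∑ i', (c.1 i' : ℝ) * z (Fin.castAdd k i') + (c.2 : ℝ)) (hi i)} ∧ EqOn s.integrand (fun z => MvPolynomial.aeval (fun i => z (Fin.castAdd k (Fin.castSucc i))) p / (∏ j, (∑ i, ((L j).1 i : ℝ) * z (Fin.castAdd k (Fin.castSucc i)) + ((L j).2 : ℝ)) ^ e j) * ((z (Fin.castAdd k (Fin.last b)) - (∑ i, (ℓ₁.1 i : ℝ) * z (Fin.castAdd k (Fin.castSucc i)) + (ℓ₁.2 : ℝ))) ^ n₁ / (z (Fin.castAdd k (Fin.last b)) - (∑ i, (ℓ₂.1 i : ℝ) * z (Fin.castAdd k (Fin.castSucc i)) + (ℓ₂.2 : ℝ)))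 ^ n₂) * ∏ i, (a i).elim 1 (fun c => 1 / (z (Fin.natAdd (b + 1) i) - (∑ i', (c.1 i' : ℝ) * z (Fin.castAdd k i') + (c.2 : ℝ))))) s.domain ∧ w = KZ.of s}) (JJ' JD' : Set KZ.FormalRep) (b k m m' n₁ : ℕ) (s : KZ.IntegralRep (b + 1 + 1 + (k + 2))) (M : Fin m' → (Fin (b + 1 + 1) → ℚ) × ℚ) (L : Fin m → (Fin (b + 1) → ℚ) × ℚ) (e : Fin m → ℕ) (p : MvPolynomial (Fin (b + 1)) ℚ) (ℓ₁ ℓ₂ : (Fin (b + 1) → ℚ) × ℚ) (a : Fin (k + 2) → Option ((Fin (b + 1 + 1) → ℚ) × ℚ)) (lo hi : Fin (k + 2) → Fin (k + 2) ⊕ ((Fin (b + 1 + 1) → ℚ) × ℚ)) (U V : Fin (k + 2) → (Fin (b + 1 + 1) → ℚ) × ℚ) (hlo : ∀ i, lo i = Sum.inr (U i)) (hhi : ∀ i, hi i = Sum.inr (V i)) (h12 : n₁ = 0 ∨ (1 : ℕ) = 0) (hbd : Bornology.IsBounded s.domain) (hdom : s.domain = SeparatePos.gDom (b + 1) (k +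 2) m' M lo hi) (hint : EqOn s.integrand (RebasePos.glit (b + 1) (k + 2) p L e ℓ₁ ℓ₂ n₁ 1 a) s.domain) (htame : ∀ i, (∀ c, a i = some c → (U i).1 (Fin.last (b + 1)) = c.1 (Fin.last (b + 1)) ∨ (V i).1 (Fin.last (b + 1)) = c.1 (Fin.last (b + 1))) ∨ ∃ c₀ : ℝ, 0 < c₀ ∧ ∀ z ∈ s.domain, SeparatePos.affF (b + 1) (k + 2) (U i) z + c₀ ≤ SeparatePos.affF (b + 1) (k + 2) (V i) z) : ∃ c ∈ AddSubgroup.closure (GG (b + 1) 2 (k + 2) ∪ JJ' ∪ JD'), KZ.of s - c ∈ KZ.relations := by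
  rw [show GG (b + 1) 2 (k + 2) = SeparatePos.GGset (b + 1) 2 (k + 2) from hGG (b + 1) 2 (k + 2)]
  refine RebaseMany.good_widen (fun x hx => Or.inl (Or.inl hx)) ?_
  exact RebaseMany.good_literal_tame s M L e p ℓ₁ ℓ₂ a lo hi U V hlo hhi h12 hbd hdom hint htame

/-- **The product case in general position, in the skeleton's spelling** (`GG`, `hGG`; the stub's
base dimension `b + 2`, `k + 2` fibres, `n₂ = 1`, wide target `GG (b+1) 2 (k+2) ∪ JJ' ∪ JD'` for
ANY sets `JJ'`, `JD'`): product fibres in general position over the closed base cell. -/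
theorem rebaseSimplePosMany_product_generic' (GG : ℕ → ℕ → ℕ → Set KZ.FormalRep) (hGG : ∀ b σ k, GG b σ k = {w : KZ.FormalRep | ∃ (m m' n₁ n₂ : ℕ) (s : KZ.IntegralRep (b + 1 + k)) (M : Fin m' → (Fin (b + 1) → ℚ) × ℚ) (L : Fin m → (Fin b → ℚ) × ℚ) (e : Fin m → ℕ) (p : MvPolynomial (Fin b) ℚ) (ℓ₁ ℓ₂ : (Fin b → ℚ) × ℚ) (a : Fin k → Option ((Fin (b + 1) → ℚ) × ℚ)) (lo hi : Fin k → Fin k ⊕ ((Fin (b + 1) → ℚ) × ℚ)), (n₁ = 0 ∨ n₂ = 0) ∧ (σ = 2 → (∀ i c, a i = some c → c.1 (Fin.last b) = 0) ∧ (∀ i c, (lo i = Sum.inr c ∨ hi i = Sum.inr c) → (c.1 (Fin.last b) = 0 ∨ c = (Pi.single (Fin.last b) 1, 0)))) ∧ Bornology.IsBounded s.domain ∧ s.domain = {z | (∀ j, 0 < ∑ i, ((M j).1 i : ℝ) * z (Fin.castAdd k i) + ((M j).2 : ℝ)) ∧ ∀ i, Sum.elim (fun j => z (Fin.natAdd (b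 + 1) j)) (fun c => ∑ i', (c.1 i' : ℝ) * z (Fin.castAdd k i') + (c.2 : ℝ)) (lo i) < z (Fin.natAdd (b + 1) i) ∧ z (Fin.natAdd (b + 1) i) < Sum.elim (fun j => z (Fin.natAdd (b + 1) j)) (fun c => ∑ i', (c.1 i' : ℝ) * z (Fin.castAdd k i') + (c.2 : ℝ)) (hi i)} ∧ EqOn s.integrand (fun z => MvPolynomial.aeval (fun i => z (Fin.castAdd k (Fin.castSucc i))) p / (∏ j, (∑ i, ((L j).1 i : ℝ) * z (Fin.castAdd k (Fin.castSucc i)) + ((L j).2 : ℝ)) ^ e j) * ((z (Fin.castAdd k (Fin.last b)) - (∑ i, (ℓ₁.1 i : ℝ) * z (Fin.castAdd k (Fin.castSucc i)) + (ℓ₁.2 : ℝ))) ^ n₁ / (z (Fin.castAdd k (Fin.last b)) - (∑ i, (ℓ₂.1 i : ℝ) * z (Fin.castAdd k (Fin.castSucc i)) + (ℓ₂.2 : ℝ))) ^ n₂) * ∏ i, (a i).elim 1 (fun c => 1 / (z (Fin.natAdd (b + 1) i) - (∑ i', (c.1 i' : ℝ) * z (Fin.castAdd k i') + (c.2 : ℝ)))))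 s.domain ∧ w = KZ.of s}) (JJ' JD' : Set KZ.FormalRep) (b k m m' n₁ : ℕ) (s : KZ.IntegralRep (b + 1 + 1 + (k + 2))) (M : Fin m' → (Fin (b + 1 + 1) → ℚ) × ℚ) (L : Fin m → (Fin (b + 1) → ℚ) × ℚ) (e : Fin m → ℕ) (p : MvPolynomial (Fin (b + 1)) ℚ) (ℓ₁ ℓ₂ : (Fin (b + 1) → ℚ) × ℚ) (a : Fin (k + 2) → Option ((Fin (b + 1 + 1) → ℚ) × ℚ)) (lo hi : Fin (k + 2) → Fin (k + 2) ⊕ ((Fin (b + 1 + 1) → ℚ) × ℚ)) (U V : Fin (k + 2) → (Fin (b + 1 + 1) → ℚ) × ℚ) (hlo : ∀ i, lo i = Sum.inr (U i)) (hhi : ∀ i, hi i = Sum.inr (V i)) (h12 : n₁ = 0 ∨ (1 : ℕ) = 0) (hbd : Bornology.IsBounded s.domain) (hdom : s.domain = SeparatePos.gDom (b + 1) (k + 2) m' M lo hi) (hint : EqOn s.integrand (RebasePos.glit (b + 1) (k + 2) p L e ℓ₁ ℓ₂ n₁ 1 a) s.domain) (hgen : ∀ i c, a i = some c → (U i).1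 (Fin.last (b + 1)) ≠ c.1 (Fin.last (b + 1)) → (V i).1 (Fin.last (b + 1)) ≠ c.1 (Fin.last (b + 1)) → ∀ z : Fin (b + 1 + 1 + (k + 2)) → ℝ, (∀ j, 0 ≤ SeparatePos.affF (b + 1) (k + 2) (M j) z) → (∀ i', SeparatePos.affF (b + 1) (k + 2) (U i') z ≤ SeparatePos.affF (b + 1) (k + 2) (V i') z) → SeparatePos.affF (b + 1) (k + 2) (U i) z = SeparatePos.affF (b + 1) (k + 2) (V i) z → (U i).1 (Fin.last (b + 1)) ≠ (V i).1 (Fin.last (b + 1)) ∧ SeparatePos.affF (b + 1) (k + 2) (U i) z ≠ SeparatePos.affF (b + 1) (k + 2) c z) : ∃ c ∈ AddSubgroup.closure (GG (b + 1) 2 (k + 2) ∪ JJ' ∪ JD'), KZ.of s - c ∈ KZ.relations := by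
  rw [show GG (b + 1) 2 (k + 2) = SeparatePos.GGset (b + 1) 2 (k + 2) from hGG (b + 1) 2 (k + 2)]
  refine RebaseMany.good_widen (fun x hx => Or.inl (Or.inl hx)) ?_
  exact RebaseMany.good_literal_generic s M L e p ℓ₁ ℓ₂ a lo hi U V hlo hhi h12 hbd hdom hint hgen

end Summit.KontsevichZagierPeriods.ArrangementNormalForm.JanusBands
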